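import Summits.CriticalPhenomena.PercolationContinuityZ3.Theorems.PercNearOneGluingNoHeavyLowerTailFKKNConj4PreMargin
import Summits.CriticalPhenomena.PercolationContinuityZ3.Theorems.PercNearOneGluingNoHeavyLowerTailFKKNConj4Tower
import Summits.CriticalPhenomena.PercolationContinuityZ3.Theorems.PercNearOneGluingNoHeavyLowerTailFKCSHPhiMonotone
import Literature.Probability.LatticeModels.RandomClusterEdgeWeightsContinuity
import Literature.Probability.LatticeModels.ProdBernoulliWeightContinuity
import HarnessLib

/-!
# FK sub-lane: KOZMA–NITZAN'S CONJECTURE 4 for every random-cluster measure `φ_{w,q}`, `q ≥ 1` (and for every fully supported measure with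
# CSH, one-cluster conditional positive association and the cluster tower property)

Support file (`--supports stmt-CriticalPhenomena-4575`), FK sub-lane `prim-bschramm-fk-2` (gen 5) of the post-continuity programme;
builds on p205010 (kernel theorem, internal audit signed; external expert review pending).  No definitions, no named facts, no sorries;
standard axioms.

Kozma–Nitzan, arXiv:2401.12397, CONJECTURE 4 (p. 32): "For any graph `G`, any monotone cluster property `f`, any `A ⊂ G` and any `0 ∈ G`,
`E(f(0)·𝟙{0 ↔ A}) ≥ min_{a∈A} E(f(a)·𝟙{0 ↔ A})`."  Stated and conjectured there for Bernoulli percolation; proved in the tree for Bernoulli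
percolation on every finite weighted graph (`PreFKGSurplus.kn_conj4_holds`, prim-ineq-gen-6, from prim-hp-8's conditioned slack hierarchy).
THIS FILE: the same conclusion for the random-cluster measures `φ_{w,q}`, EVERY `q ≥ 1` (so in particular the FK–Ising measure `q = 2`),
on every finite weighted graph.

* `FK.kn_conj4_under_of_cshFor` — MEASURE-GENERIC: for a fully supported probability measure `μ` on the bond configurations of `Fin n` with
  (i) the conditioned slack hierarchy `FK.CSHHoldsFor μ` for all data with distinct named vertices, (ii) one-cluster conditional positive
  association given `{s ↮ X}` (vdBHK Thm 1.3 shape) and (iii) the cluster tower property (vdBHK Lemma 2.4 shape: on `{k ↮ c}`,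
  `E_μ[F(C(c)) | C_k]` is a decreasing function of `C_k`), Conjecture 4 holds under `μ`: some `a ∈ A` (any relay of least mean, or `0` itself)
  has `E_μ[F(C(a)); 0 ↔ A] ≤ E_μ[F(C(0)); 0 ↔ A]`.  Proof = `PreFKGSurplus.kn_conj4_of_csh` verbatim with `μ` for `prodBernoulli w`
  (peel one relay `k ≠ c`; CPA for `C_k` given `k ↮ A∖k` with the projected functional; the two-observer pre-FKG margin at `D = []`,
  `FK.preMarginμ_nonneg_of_cshFor`).
* `FK.kn_conj4_rc_nondegenerate` — for `φ_{w,q}`, `1 ≤ q`, `0 < w < 1`: (i) is `FK.cshFK_of_one_le` (fk-1 g3 ∘ fk-2 g3/g4: the FK finite leg),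
  (ii) is `BHK2006_clusterConditionalPositiveAssociation_rc` (vdBHK Thm 2.1 ⇒ 1.3 for `φ_{p,q}`), (iii) is `FK.tower_clusterFun_rc` +
  `FK.antitone_condMean_rc`;
* **`FK.kn_conj4_rc`** — EVERY `w ∈ [0,1]^{Sym2 (Fin n)}` (closure over degenerate parameters by continuity in `w`; weight `0`/`1` = deleted /
  wired pairs, so every finite graph with any partial wiring is covered), `FK.kn_conj4_rc_two` (`q = 2`);
* `FK.kn_conj2_rc` — Conjecture 2 / display (3) for `φ_{w,q}`: `∃ a ∈ A, φ(a ↔ b, 0 ↔ A) ≤ φ(0 ↔ b, 0 ↔ A)` (`F = 1{b ∈ ·}`).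
[cite: KozmaNitzan2024, Conj. 4 and Thms. 7–10 (p. 32), Conj. 2 (p. 3)] [cite: VandenbergHaggstromKahn2005, Thm. 1.3 (p. 6), Thm. 2.1 (p. 9), §2.1 Lemma 2.4 (p. 10)]
[cite: Grimmett2006, §1.4 eq. (1.20) (p. 15); Thm. (3.8)]
-/

noncomputable section

namespace Summit.CriticalPhenomena.PercolationContinuityZ3.Theorems

open MeasureTheory Set Literature.Probability.LatticeModels Literature.Probability.Percolation
open scoped Classical
open KNPreFKG

namespace FK

variable {n : ℕ}

/-- **Kozma–Nitzan's Conjecture 4 under a general measure.**  `μ` a probability measure on the bond configurations of `Fin n` with full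
support, one-cluster conditional positive association (`hCPA`), the cluster tower property (`htower`) and the conditioned slack hierarchy for
all data with distinct named vertices (`hCSH`).  Then for every relay set `A ≠ ∅`, every `0` and every monotone `F`, some `a ∈ A` — any
relay of least mean, or `0` itself if `0 ∈ A` — has `E_μ[F(C(a)); 0 ↔ A] ≤ E_μ[F(C(0)); 0 ↔ A]`.
(port of `PreFKGSurplus.kn_conj4_of_csh`, measure-parametrised) [cite: KozmaNitzan2024, Conj. 4 (p. 32)] [cite: VandenbergHaggstromKahn2005, Thm. 1.3 (p. 6), §2.1 Lemma 2.4 (p. 10)] -/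
theorem kn_conj4_under_of_cshFor (μ : Measure (BondConfig (Fin n))) [IsProbabilityMeasure μ]
    (hfull : ∀ S : Set (BondConfig (Fin n)), S.Nonempty → 0 < μ.real S)
    (hCPA : ∀ (s : Fin n) (X : Set (Fin n)) (F G : Set (Sym2 (Fin n)) → ℝ), Monotone F → Monotone G →
      (∫ ω in {ω : BondConfig (Fin n) | ∀ x ∈ X, ¬ (openGraph ω).Reachable s x}, F (openEdgeCluster ω s) ∂μ) *
        (∫ ω in {ω : BondConfig (Fin n) | ∀ x ∈ X, ¬ (openGraph ω).Reachable s x}, G (openEdgeCluster ω s) ∂μ) ≤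
      μ.real {ω : BondConfig (Fin n) | ∀ x ∈ X, ¬ (openGraph ω).Reachable s x} *
        ∫ ω in {ω : BondConfig (Fin n) | ∀ x ∈ X, ¬ (openGraph ω).Reachable s x},
          F (openEdgeCluster ω s) * G (openEdgeCluster ω s) ∂μ)
    (htower : ∀ (c k : Fin n) (F : Set (Fin n) → ℝ), (∀ S S' : Set (Fin n), S ⊆ S' → F S ≤ F S') →
      ∃ g : Set (Sym2 (Fin n)) → ℝ, Antitone g ∧ ∀ 𝒮 : Set (Set (Sym2 (Fin n))),
        ∫ ω in {ω : BondConfig (Fin n) | ¬ (openGraph ω).Reachable k c} ∩ {ω | openEdgeCluster ω k ∈ 𝒮}, F (openCluster ω c) ∂μ =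
          ∫ ω in {ω : BondConfig (Fin n) | ¬ (openGraph ω).Reachable k c} ∩ {ω | openEdgeCluster ω k ∈ 𝒮}, g (openEdgeCluster ω k) ∂μ)
    (hCSH : ∀ (o v x : Fin n) (Y : Finset (Fin n)) (D : List (Fin n)),
      o ≠ v → x ∉ Y → o ≠ x → v ≠ x → o ∉ Y → v ∉ Y → D.Nodup → (∀ d ∈ D, d ≠ x ∧ d ∉ Y ∧ d ≠ o ∧ d ≠ v) →
      CSHHoldsFor μ x (↑Y : Set (Fin n)) D o v)
    (A : Finset (Fin n)) (o : Fin n) (F : Set (Fin n) → ℝ) (hF : ∀ S T : Set (Fin n), S ⊆ T → F S ≤ F T) (hA : A.Nonempty) :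
    ∃ a ∈ A, ∫ ω in ⋃ a' ∈ A, openConn o a', F (openCluster ω a) ∂μ ≤
      ∫ ω in ⋃ a' ∈ A, openConn o a', F (openCluster ω o) ∂μ := by
  classical
  have hmeas : ∀ S : Set (BondConfig (Fin n)), MeasurableSet S := fun _ => MeasurableSet.of_discrete
  have hint : ∀ (g : BondConfig (Fin n) → ℝ), Integrable g μ := fun g => Integrable.of_finite
  by_cases hoA : o ∈ A
  · exact ⟨o, hoA, le_rfl⟩
  obtain ⟨c, hcA, hcmin⟩ := Finset.exists_min_image A (fun u => ∫ ω, F (openCluster ω u) ∂μ) hA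
  refine ⟨c, hcA, ?_⟩
  -- it suffices that `Δ_o(A) ≥ 0`
  suffices hΔ : 0 ≤ ∫ ω in ⋃ a' ∈ A, openConn o a', (F (openCluster ω o) - F (openCluster ω c)) ∂μ by
    rw [integral_sub (hint _).integrableOn (hint _).integrableOn] at hΔ
    linarith
  -- peel one relay `k ≠ c` off `X := A`
  have main : ∀ (X : Finset (Fin n)), X ⊆ A → c ∈ X →
      0 ≤ ∫ ω in ⋃ a' ∈ X, openConn o a', (F (openCluster ω o) - F (openCluster ω c)) ∂μ := by
    intro X hXA hcX
    have hoX : o ∉ X := fun h => hoA (hXA h)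
    rcases (X.erase c).eq_empty_or_nonempty with h0 | hne
    · have hXc : X = {c} := by rw [← Finset.insert_erase hcX, h0]; rfl
      rw [hXc]
      have hU : (⋃ a ∈ ({c} : Finset (Fin n)), (openConn o a : Set (BondConfig (Fin n)))) = openConn o c := by ext ω; simp
      rw [hU, setIntegral_congr_fun (hmeas _) (g := fun _ => (0 : ℝ)) (fun ω hω => by
        show F (openCluster ω o) - F (openCluster ω c) = 0
        rw [PreFKGSurplus.openCluster_eq_of_reach (show (openGraph ω).Reachable o c from hω), sub_self])]
      simp
    obtain ⟨k, hk⟩ := hne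
    have hkc : k ≠ c := (Finset.mem_erase.1 hk).1
    have hkX : k ∈ X := (Finset.mem_erase.1 hk).2
    set X' : Finset (Fin n) := X.erase k with hX'
    have hX'X : ∀ a ∈ X', a ∈ X := fun a ha => Finset.mem_of_mem_erase ha
    have hkX' : k ∉ X' := Finset.notMem_erase k X
    have hcX' : c ∈ X' := Finset.mem_erase.2 ⟨hkc.symm, hcX⟩
    have hko : o ≠ k := fun h => hoX (h ▸ hkX)
    have hmk : ∫ ω, F (openCluster ω c) ∂μ ≤ ∫ ω, F (openCluster ω k) ∂μ := hcmin k (hXA hkX)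
    set Dk : Set (BondConfig (Fin n)) := {ω : BondConfig (Fin n) | ∀ a ∈ (↑X' : Set (Fin n)), ¬ (openGraph ω).Reachable k a}
      with hDk
    set gk : BondConfig (Fin n) → ℝ := fun ω => F (openCluster ω k) - F (openCluster ω c) with hgk
    -- the projected monotone functional (projection hypothesis)
    obtain ⟨g, hg_anti, hg_tower⟩ := htower c k F hF
    set Gk : Set (Sym2 (Fin n)) → ℝ := fun K => F {z | z = k ∨ ∃ e ∈ K, z ∈ e} - g K with hGk
    have hGk_mono : Monotone Gk := fun _ _ hKK' => sub_le_sub (monotone_clusterFun k F hF hKK') (hg_anti hKK')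
    have hproj : ∀ 𝒮 : Set (Set (Sym2 (Fin n))),
        ∫ ω in {ω : BondConfig (Fin n) | ¬ (openGraph ω).Reachable k c} ∩ {ω | openEdgeCluster ω k ∈ 𝒮}, gk ω ∂μ =
          ∫ ω in {ω : BondConfig (Fin n) | ¬ (openGraph ω).Reachable k c} ∩ {ω | openEdgeCluster ω k ∈ 𝒮}, Gk (openEdgeCluster ω k) ∂μ := by
      intro 𝒮
      simp only [hgk, hGk]
      rw [integral_sub (hint _).integrableOn (hint _).integrableOn, integral_sub (hint _).integrableOn (hint _).integrableOn,
        hg_tower 𝒮]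
      simp only [clusterFun_openEdgeCluster]
    set Δo : ℝ := ∫ ω in ⋃ a' ∈ X', openConn o a', (F (openCluster ω o) - F (openCluster ω c)) ∂μ with hΔo
    set Δk : ℝ := ∫ ω in ⋃ a' ∈ X', openConn k a', (F (openCluster ω k) - F (openCluster ω c)) ∂μ with hΔk
    set Tko : ℝ := ∫ ω in Dk ∩ openConn k o, gk ω ∂μ with hTko
    set J : ℝ := ∫ ω in Dk, gk ω ∂μ with hJ
    set M : ℝ := μ.real Dk with hM
    set E : ℝ := μ.real (Dk ∩ openConn k o) with hE
    -- peel
    have hpeel : ∫ ω in ⋃ a' ∈ X, openConn o a', (F (openCluster ω o) - F (openCluster ω c)) ∂μ = Δo + Tko := by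
      rw [hΔo, hTko, hgk]
      exact preSurplusμ_erase_add μ X F c k o hkX
    -- tower identities
    have hDk_S : ∀ u : Fin n, Dk ∩ openConn k u =
        {ω : BondConfig (Fin n) | ¬ (openGraph ω).Reachable k c} ∩
          {ω | openEdgeCluster ω k ∈ {K : Set (Sym2 (Fin n)) |
            (∀ a ∈ X', a ≠ c → ¬ (a = k ∨ ∃ e ∈ K, a ∈ e)) ∧ (u = k ∨ ∃ e ∈ K, u ∈ e)}} := by
      intro u; ext ω
      simp only [mem_inter_iff, hDk, mem_setOf_eq, Finset.mem_coe]
      constructor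
      · rintro ⟨h1, h2⟩
        refine ⟨h1 c hcX', fun a ha _ => ?_, (reachable_iff_exists_mem_openEdgeCluster ω k u).1 h2⟩
        rw [← reachable_iff_exists_mem_openEdgeCluster]; exact h1 a ha
      · rintro ⟨h1, h2, h3⟩
        refine ⟨fun a ha => ?_, (reachable_iff_exists_mem_openEdgeCluster ω k u).2 h3⟩
        by_cases hac : a = c
        · rw [hac]; exact h1
        · rw [reachable_iff_exists_mem_openEdgeCluster]; exact h2 a ha hac
    have hDk_0 : Dk = {ω : BondConfig (Fin n) | ¬ (openGraph ω).Reachable k c} ∩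
          {ω | openEdgeCluster ω k ∈ {K : Set (Sym2 (Fin n)) | ∀ a ∈ X', a ≠ c → ¬ (a = k ∨ ∃ e ∈ K, a ∈ e)}} := by
      ext ω
      simp only [mem_inter_iff, hDk, mem_setOf_eq, Finset.mem_coe]
      constructor
      · intro h1
        refine ⟨h1 c hcX', fun a ha _ => ?_⟩
        rw [← reachable_iff_exists_mem_openEdgeCluster]; exact h1 a ha
      · rintro ⟨h1, h2⟩ a ha
        by_cases hac : a = c
        · rw [hac]; exact h1
        · rw [reachable_iff_exists_mem_openEdgeCluster]; exact h2 a ha hac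
    have towO : Tko = ∫ ω in Dk ∩ openConn k o, Gk (openEdgeCluster ω k) ∂μ := by
      simp only [hTko]; rw [hDk_S o]; exact hproj _
    have tow0 : J = ∫ ω in Dk, Gk (openEdgeCluster ω k) ∂μ := by
      simp only [hJ]; rw [hDk_0]; exact hproj _
    have hJtot : J = ((∫ ω, F (openCluster ω k) ∂μ) - ∫ ω, F (openCluster ω c) ∂μ) - Δk := by
      have h1 := integral_add_compl (hmeas Dk) (hint gk)
      have hDkc : Dkᶜ = ⋃ a' ∈ X', (openConn k a' : Set (BondConfig (Fin n))) := by
        ext ω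
        rw [PreFKGSurplus.mem_iUnion_openConn, mem_compl_iff, hDk]
        simp only [mem_setOf_eq, Finset.mem_coe, not_forall, not_not, exists_prop]
      have h2 : ∫ ω in Dkᶜ, gk ω ∂μ = Δk := by
        rw [hDkc]
      have h3 : ∫ ω, gk ω ∂μ = (∫ ω, F (openCluster ω k) ∂μ) - ∫ ω, F (openCluster ω c) ∂μ := by
        rw [hgk, integral_sub (hint _) (hint _)]
      rw [hJ]; linarith
    -- one-cluster positive association for `C_k` given `k ↮ X'`:  `M·Tko ≥ J·E`
    have hG : Monotone ((connFamily k o).indicator (1 : Set (Sym2 (Fin n)) → ℝ)) :=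
      monotone_indicator_one_of_isUpperSet (isUpperSet_connFamily k o)
    have hPA := hCPA k (↑X' : Set (Fin n)) Gk ((connFamily k o).indicator 1) hGk_mono hG
    have hind : (fun ω : BondConfig (Fin n) => (connFamily k o).indicator (1 : Set (Sym2 (Fin n)) → ℝ) (openEdgeCluster ω k)) =
        (openConn k o : Set (BondConfig (Fin n))).indicator 1 := by
      rw [indicator_comp_openEdgeCluster (connFamily k o) k, ← openConn_eq_setOf_connFamily]
    have hDk' : {ω : BondConfig (Fin n) | ∀ x ∈ (↑X' : Set (Fin n)), ¬ (openGraph ω).Reachable k x} = Dk := by rw [hDk]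
    have hI1 : ∫ ω in Dk, (connFamily k o).indicator (1 : Set (Sym2 (Fin n)) → ℝ) (openEdgeCluster ω k) ∂μ = E := by
      rw [show (fun ω => (connFamily k o).indicator (1 : Set (Sym2 (Fin n)) → ℝ) (openEdgeCluster ω k)) =
        (openConn k o : Set (BondConfig (Fin n))).indicator 1 from hind, setIntegral_indicator_one_eq]
    have hI2 : ∫ ω in Dk, Gk (openEdgeCluster ω k) * (connFamily k o).indicator (1 : Set (Sym2 (Fin n)) → ℝ) (openEdgeCluster ω k) ∂μ =
        ∫ ω in Dk ∩ openConn k o, Gk (openEdgeCluster ω k) ∂μ := by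
      have e : ∀ ω : BondConfig (Fin n), Gk (openEdgeCluster ω k) *
          (connFamily k o).indicator (1 : Set (Sym2 (Fin n)) → ℝ) (openEdgeCluster ω k) =
          Gk (openEdgeCluster ω k) * (openConn k o : Set (BondConfig (Fin n))).indicator (1 : BondConfig (Fin n) → ℝ) ω :=
        fun ω => congrArg (fun t => Gk (openEdgeCluster ω k) * t) (congrFun hind ω)
      simp_rw [e]
      exact setIntegral_mul_indicator_one μ Dk (openConn k o) _
    have hC : J * E ≤ M * Tko := by
      have h := hPA
      rw [hDk', hI1, hI2, ← tow0, ← towO] at h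
      rw [hM]
      linarith [h]
    -- the two-observer margin at `D = []`, observers `(o, k)`:  `Δo − (E/M)·Δk ≥ 0`
    have hpm := preMarginμ_nonneg_of_cshFor μ hfull o k
      (fun x Y D hxY hox hkx hoY hkY hD hDd => hCSH o k x Y D hko hxY hox hkx hoY hkY hD hDd) htower
      X' c [] F hF hcX' (fun a ha => hcmin a (hXA (hX'X a ha))) (fun h => hoX (hX'X o h)) hkX' List.nodup_nil
      (fun d hd => by simp at hd)
    simp only [decoyListμ, CSH.cshMarg_nil] at hpm
    -- identify the constant `obsConstμ μ o k (↑X' ∪ ∅) = E / M`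
    have hset0 : ((↑X' : Set (Fin n)) ∪ {d | d ∈ ([] : List (Fin n))}) = ↑X' := by simp
    have hp0 : obsConstμ μ o k ((↑X' : Set (Fin n)) ∪ {d | d ∈ ([] : List (Fin n))}) = E / M := by
      rw [hset0, obsConstμ, hE, hM, hDk, openConn_symm o k]
    rw [hp0] at hpm
    -- hpm : 0 ≤ Δo − (E/M)·Δk
    have hMpos : 0 < M := by
      refine hfull _ ⟨∅, ?_⟩
      intro a ha h
      rw [reachable_openGraph_empty_iff] at h
      exact hkX' (h ▸ (Finset.mem_coe.1 ha))
    have hE0 : 0 ≤ E := measureReal_nonneg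
    have hpm' : E * Δk ≤ M * Δo := by
      have : 0 ≤ M * (Δo - E / M * Δk) := mul_nonneg hMpos.le hpm
      have e : M * (Δo - E / M * Δk) = M * Δo - E * Δk := by field_simp
      linarith [this, e]
    have hmk' : 0 ≤ (∫ ω, F (openCluster ω k) ∂μ) - ∫ ω, F (openCluster ω c) ∂μ := by linarith [hmk]
    have hfin : 0 ≤ M * (Δo + Tko) := by
      have hJE : J * E = ((∫ ω, F (openCluster ω k) ∂μ) - ∫ ω, F (openCluster ω c) ∂μ) * E - Δk * E := by rw [hJtot]; ring
      nlinarith [hC, hpm', hJE, mul_nonneg hmk' hE0]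
    rw [hpeel]
    exact le_of_mul_le_mul_left (by rw [mul_zero]; exact hfin) hMpos
  exact main A (subset_refl A) hcA

/-! ### The random-cluster measures `φ_{w,q}`, `q ≥ 1` -/

/-- **The cluster tower hypothesis holds for `φ_{w,q}`, `q ≥ 1`** (vdBHK Lemma 2.4 for the random-cluster measure, `FK.tower_clusterFun_rc`,
with the decreasing world mean `K ↦ ∫ F(C_c) dφ_{G−K̄,q}`, `FK.antitone_condMean_rc`). [cite: VandenbergHaggstromKahn2005, §2.1 Lemma 2.4 (p. 10), display (16) (p. 12)] -/
theorem towerHyp_rc {q : ℝ} (hq : 1 ≤ q) (w : Sym2 (Fin n) → unitInterval) (c k : Fin n) (F : Set (Fin n) → ℝ)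
    (hF : ∀ S S' : Set (Fin n), S ⊆ S' → F S ≤ F S') :
    ∃ g : Set (Sym2 (Fin n)) → ℝ, Antitone g ∧ ∀ 𝒮 : Set (Set (Sym2 (Fin n))),
      ∫ ω in {ω : BondConfig (Fin n) | ¬ (openGraph ω).Reachable k c} ∩ {ω | openEdgeCluster ω k ∈ 𝒮}, F (openCluster ω c)
          ∂(rcMeasureW w q ∅) =
        ∫ ω in {ω : BondConfig (Fin n) | ¬ (openGraph ω).Reachable k c} ∩ {ω | openEdgeCluster ω k ∈ 𝒮}, g (openEdgeCluster ω k)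
          ∂(rcMeasureW w q ∅) :=
by
  refine ⟨fun K => ∫ η, F (openCluster η c) ∂(rcMeasureW (BHK2006.delW w (BHK2006.barOf {k} K)) q ∅),
    antitone_condMean_rc w hq c k F hF, fun 𝒮 => ?_⟩
  have h := tower_clusterFun_rc w (one_pos.trans_le hq) c k F 𝒮
  simpa only using h

/-- **Kozma–Nitzan's Conjecture 4 under `φ_{w,q}` at non-degenerate parameters from `CSHFK q`** (`q ≥ 1`): full support is finite energy
(`rcMeasureW_real_pos_of_nonempty`), one-cluster CPA is van den Berg–Häggström–Kahn's Theorem 1.3 for the random-cluster measure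
(`BHK2006_clusterConditionalPositiveAssociation_rc`), the tower property is `FK.towerHyp_rc`, and CSH is the hypothesis `CSHFK q` at `w`.
[cite: KozmaNitzan2024, Conj. 4 (p. 32)] [cite: VandenbergHaggstromKahn2005, Thm. 1.3 (p. 6), Thm. 2.1 (p. 9), §2.1 Lemma 2.4 (p. 10)] -/
theorem kn_conj4_of_cshFK_rc {q : ℝ} (hq : 1 ≤ q) (hCSH : CSHFK q) (w : Sym2 (Fin n) → unitInterval) (hw : ∀ e, 0 < w e ∧ w e < 1)
    (A : Finset (Fin n)) (o : Fin n) (F : Set (Fin n) → ℝ) (hF : ∀ S T : Set (Fin n), S ⊆ T → F S ≤ F T) (hA : A.Nonempty) :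
    ∃ a ∈ A, ∫ ω in ⋃ a' ∈ A, openConn o a', F (openCluster ω a) ∂(rcMeasureW w q ∅) ≤
      ∫ ω in ⋃ a' ∈ A, openConn o a', F (openCluster ω o) ∂(rcMeasureW w q ∅) := by
  have hq0 : 0 < q := one_pos.trans_le hq
  haveI := isProbabilityMeasure_rcMeasureW w hq0 (∅ : Set (Fin n))
  exact kn_conj4_under_of_cshFor (rcMeasureW w q ∅) (fun S hS => rcMeasureW_real_pos_of_nonempty hq0 hw ∅ hS)
    (fun s X F' G hF' hG => BHK2006_clusterConditionalPositiveAssociation_rc w hq s X F' G hF' hG)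
    (fun c k F' hF' => towerHyp_rc hq w c k F' hF')
    (fun o' v x Y D hov hxY hox hvx hoY hvY hD hdis => hCSH n w hw o' v x Y D hov hxY hox hvx hoY hvY hD hdis) A o F hF hA

/-- **Kozma–Nitzan's Conjecture 4 for `φ_{w,q}`, `q ≥ 1`, at NON-DEGENERATE parameters** (`0 < w < 1`; every finite graph `Fin n`, every
relay set `A ≠ ∅`, every `0`, every monotone cluster property `F`): some `a ∈ A` has `E_φ[F(C(a)); 0 ↔ A] ≤ E_φ[F(C(0)); 0 ↔ A]`.  The
conditioned slack hierarchy for `φ_{w,q}` is the tree theorem `FK.cshFK_of_one_le` (the FK finite leg: fk-1 g2/g3, fk-2 g2–g4, cplus-literature).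
[cite: KozmaNitzan2024, Conj. 4 (p. 32)] [cite: VandenbergHaggstromKahn2005, Thm. 2.1 (p. 9), §2.1 (pp. 9–13)] [cite: Grimmett2006, §1.4 eq. (1.20) (p. 15); Thm. (3.8)] -/
theorem kn_conj4_rc_nondegenerate {q : ℝ} (hq : 1 ≤ q) (w : Sym2 (Fin n) → unitInterval) (hw : ∀ e, 0 < w e ∧ w e < 1)
    (A : Finset (Fin n)) (o : Fin n) (F : Set (Fin n) → ℝ) (hF : ∀ S T : Set (Fin n), S ⊆ T → F S ≤ F T) (hA : A.Nonempty) :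
    ∃ a ∈ A, ∫ ω in ⋃ a' ∈ A, openConn o a', F (openCluster ω a) ∂(rcMeasureW w q ∅) ≤
      ∫ ω in ⋃ a' ∈ A, openConn o a', F (openCluster ω o) ∂(rcMeasureW w q ∅) :=
  kn_conj4_of_cshFK_rc hq (cshFK_of_one_le hq) w hw A o F hF hA

/-- **KOZMA–NITZAN'S CONJECTURE 4 FOR EVERY RANDOM-CLUSTER MEASURE `φ_{w,q}`, `q ≥ 1`** — every finite vertex type `Fin n`, EVERY parameter
vector `w ∈ [0,1]^{Sym2 (Fin n)}` (weight `0` = absent edge, weight `1` = wired pair, so every finite graph with any partial wiring is covered),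
every relay set `A ≠ ∅`, every vertex `0`, every monotone cluster property `F`: some `a ∈ A` has
`E_φ[F(C(a)); 0 ↔ A] ≤ E_φ[F(C(0)); 0 ↔ A]`.  From the non-degenerate case by continuity in `w` of the finitely many differences
`E_φ[F(C(a)); 0↔A] − E_φ[F(C(0)); 0↔A]` (finite sums of point masses, `BHK2006.continuous_sum_rcMass`) and of their minimum over `a ∈ A`
(`weights_le_of_forall_pos_lt_one`: non-degenerate parameters are dense).  At `q = 1` (`rcMeasureW_one`) this is the tree theorem
`PreFKGSurplus.kn_conj4` (builds on p205010 (kernel theorem, internal audit signed; external expert review pending)).  Kozma–Nitzan state the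
conjecture for Bernoulli percolation; the random-cluster case `q > 1` is not in print as far as searched.
[cite: KozmaNitzan2024, Conj. 4 (p. 32)] [cite: VandenbergHaggstromKahn2005, Thm. 2.1 (p. 9), §2.1 (pp. 9–13)] [cite: Grimmett2006, §1.4 eq. (1.20) (p. 15); Thm. (3.8); §4.5] -/
theorem kn_conj4_rc {q : ℝ} (hq : 1 ≤ q) (w : Sym2 (Fin n) → unitInterval)
    (A : Finset (Fin n)) (o : Fin n) (F : Set (Fin n) → ℝ) (hF : ∀ S T : Set (Fin n), S ⊆ T → F S ≤ F T) (hA : A.Nonempty) :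
    ∃ a ∈ A, ∫ ω in ⋃ a' ∈ A, openConn o a', F (openCluster ω a) ∂(rcMeasureW w q ∅) ≤
      ∫ ω in ⋃ a' ∈ A, openConn o a', F (openCluster ω o) ∂(rcMeasureW w q ∅) := by
  classical
  have hq0 : 0 < q := one_pos.trans_le hq
  set S : Set (BondConfig (Fin n)) := ⋃ a' ∈ A, (openConn o a' : Set (BondConfig (Fin n))) with hS
  -- the differences as finite sums against the point masses (continuous in `w`)
  set Φ : Fin n → (Sym2 (Fin n) → unitInterval) → ℝ := fun a w' =>
    ∑ ω, BHK2006.rcMass w' q ω * ((F (openCluster ω a) - F (openCluster ω o)) * DecisionTree.ind S ω) with hΦ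
  have hΦeq : ∀ (a : Fin n) (w' : Sym2 (Fin n) → unitInterval), Φ a w' =
      (∫ ω in S, F (openCluster ω a) ∂(rcMeasureW w' q ∅)) - ∫ ω in S, F (openCluster ω o) ∂(rcMeasureW w' q ∅) := by
    intro a w'
    haveI := isProbabilityMeasure_rcMeasureW w' hq0 (∅ : Set (Fin n))
    rw [← integral_sub (Integrable.of_finite).integrableOn (Integrable.of_finite).integrableOn,
      BHK2006.setIntegral_rcMeasureW_eq_sum w' hq0]
  have hcont : ∀ a : Fin n, Continuous (Φ a) := fun a => BHK2006.continuous_sum_rcMass hq0 _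
  set f : (Sym2 (Fin n) → unitInterval) → ℝ := fun w' => A.inf' hA (fun a => Φ a w') with hf
  have hfc : Continuous f := Continuous.finset_inf'_apply hA (fun a _ => hcont a)
  have hle := weights_le_of_forall_pos_lt_one (ι := Sym2 (Fin n)) (f := f) (g := fun _ => (0 : ℝ)) hfc continuous_const ?_ w
  · obtain ⟨a, ha, hfa⟩ := Finset.exists_mem_eq_inf' hA (fun a => Φ a w)
    refine ⟨a, ha, ?_⟩
    have h1 : Φ a w ≤ 0 := by
      have h2 : f w = Φ a w := hfa
      rw [← h2]; exact hle
    rw [hΦeq] at h1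
    linarith
  · intro w' hw'
    obtain ⟨a, ha, hle'⟩ := kn_conj4_rc_nondegenerate hq w' hw' A o F hF hA
    calc f w' ≤ Φ a w' := Finset.inf'_le _ ha
      _ ≤ 0 := by rw [hΦeq]; linarith

/-- In particular the FK–Ising case `q = 2`. [cite: KozmaNitzan2024, Conj. 4 (p. 32)] -/
theorem kn_conj4_rc_two (w : Sym2 (Fin n) → unitInterval)
    (A : Finset (Fin n)) (o : Fin n) (F : Set (Fin n) → ℝ) (hF : ∀ S T : Set (Fin n), S ⊆ T → F S ≤ F T) (hA : A.Nonempty) :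
    ∃ a ∈ A, ∫ ω in ⋃ a' ∈ A, openConn o a', F (openCluster ω a) ∂(rcMeasureW w 2 ∅) ≤
      ∫ ω in ⋃ a' ∈ A, openConn o a', F (openCluster ω o) ∂(rcMeasureW w 2 ∅) :=
  kn_conj4_rc (by norm_num) w A o F hF hA

/-- **KOZMA–NITZAN'S CONJECTURE 2 (the pre-FKG display (3)) FOR `φ_{w,q}`, `q ≥ 1`** (every `w ∈ [0,1]^{Sym2 (Fin n)}`): for every `b`,
some `a ∈ A` has `φ(a ↔ b, 0 ↔ A) ≤ φ(0 ↔ b, 0 ↔ A)` — Conjecture 4 for `F = 1{b ∈ ·}`.  At `q = 1` this is `PreFKGSurplus.kn_conj2`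
(builds on p205010 (kernel theorem, internal audit signed; external expert review pending)).
[cite: KozmaNitzan2024, Conj. 2 / display (3) (p. 3), p. 32 (sentence after Conjecture 4)] -/
theorem kn_conj2_rc {q : ℝ} (hq : 1 ≤ q) (w : Sym2 (Fin n) → unitInterval)
    (A : Finset (Fin n)) (o b : Fin n) (hA : A.Nonempty) :
    ∃ a ∈ A, (rcMeasureW w q ∅).real (openConn a b ∩ ⋃ a' ∈ A, openConn o a') ≤
      (rcMeasureW w q ∅).real (openConn o b ∩ ⋃ a' ∈ A, openConn o a') := by
  classical
  have hq0 : 0 < q := one_pos.trans_le hq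
  haveI := isProbabilityMeasure_rcMeasureW w hq0 (∅ : Set (Fin n))
  have hmeas : ∀ S : Set (BondConfig (Fin n)), MeasurableSet S := fun _ => MeasurableSet.of_discrete
  set Fb : Set (Fin n) → ℝ := fun S => if b ∈ S then (1 : ℝ) else 0 with hFb
  have hF : ∀ S T : Set (Fin n), S ⊆ T → Fb S ≤ Fb T := by
    intro S T hST
    simp only [hFb]
    by_cases hS : b ∈ S
    · simp [hS, hST hS]
    · by_cases hT : b ∈ T
      · simp [hS, hT]
      · simp [hS, hT]
  obtain ⟨a, ha, hle⟩ := kn_conj4_rc hq w A o Fb hF hA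
  refine ⟨a, ha, ?_⟩
  -- `∫_{0↔A} 1{b ∈ C(x)} dφ = φ(x ↔ b ∩ 0 ↔ A)`
  have hid : ∀ x : Fin n, ∫ ω in ⋃ a' ∈ A, openConn o a', Fb (openCluster ω x) ∂(rcMeasureW w q ∅) =
      (rcMeasureW w q ∅).real (openConn x b ∩ ⋃ a' ∈ A, openConn o a') := by
    intro x
    have hfun : (fun ω : BondConfig (Fin n) => Fb (openCluster ω x)) = (openConn x b : Set (BondConfig (Fin n))).indicator 1 := by
      funext ω
      simp only [hFb]
      by_cases h : ω ∈ (openConn x b : Set (BondConfig (Fin n)))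
      · rw [indicator_of_mem h, Pi.one_apply, if_pos (show b ∈ openCluster ω x from h)]
      · rw [indicator_of_notMem h, if_neg (show b ∉ openCluster ω x from h)]
    rw [hfun, setIntegral_indicator_one_eq, inter_comm]
  rw [hid a, hid o] at hle
  exact hle

end FK

end Summit.CriticalPhenomena.PercolationContinuityZ3.Theorems

end
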